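import Literature.Analysis.FluidPDE.DistributionalToWeak
import Literature.Analysis.FluidPDE.SuitableWeakRightContinuity
import Literature.Analysis.FluidPDE.KNSSLiouville
import Literature.Analysis.FluidPDE.LocalEnergyTimeShift
import HarnessLib

/-!
# A bounded suitable weak solution on a window is a bounded weak solution of KNSS

Analysis/FluidPDE proof file (theorems only; no definitions, no named facts).

Bridge between two accepted classes: a suitable weak solution `(u, p)` of the unforced
Navier–Stokes system on the open slab `(0, T) × E` (`IsSuitableWeakSolutionOn`, Caffarelli–Kohn–
Nirenberg 1982, (2.1)–(2.5)) which is pointwise bounded on the window, `‖u(t, x)‖ ≤ M` for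
`0 < t < T`, is a bounded weak solution on `(0, T)` in the sense of Koch–Nadirashvili–Seregin–Šverák
2009, §4 (ii) (`IsBoundedWeakNSSolutionOn (Ioo 0 T)`: a.e.-strongly measurable and bounded on the
slab, weakly divergence-free slices at a.e. time, and the pressure-free identity
`∫_{(0,T)} ∫ (⟪u, ∂ₜψ⟫ + ⟪u, (u·∇)ψ⟫ + ν ⟪u, Δψ⟫) dx dt = 0` against divergence-free space–time tests)
— `IsSuitableWeakSolutionOn.isBoundedWeakNSSolutionOn_of_bound`. The slices are weakly
divergence free at a.e. time by `SuitableRestart.ae_isWeaklyDivFree_slice` (`SuitableWeakRightContinuity.lean`); in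
the pressure-explicit distributional identity the pressure term `∫ p div ψ` drops for
divergence-free `ψ` and the product integral over the slab is the iterated one (Fubini, the
integrand being integrable by the cylinder tools of `DistributionalToWeak.lean`). This is the form in
which KNSS's Lemma 3.1 (`KNSS2009_weak_driftMild`) consumes a bounded solution.

## References

* L. Caffarelli, R. Kohn, L. Nirenberg, CPAM 35 (1982), §2 (2.1)–(2.5). [CaffarelliKohnNirenberg1982]
* G. Koch, N. Nadirashvili, G. Seregin, V. Šverák, Acta Math. 203 (2009) = arXiv:0709.3599, §4 p. 8
  (ii). [KochNadirashviliSereginSverak2009]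
-/

noncomputable section

open MeasureTheory Set Function Filter Metric TopologicalSpace
open _root_.Topology
open scoped Laplacian InnerProductSpace RealInnerProductSpace NNReal ENNReal

namespace Literature.Analysis.FluidPDE

variable {E : Type*} [NormedAddCommGroup E] [InnerProductSpace ℝ E] [FiniteDimensional ℝ E]
  [MeasurableSpace E] [BorelSpace E]

variable {T ν : ℝ} {u : ℝ → E → E} {p : ℝ → E → ℝ}

/-- **A pointwise-bounded field is locally square integrable on the finite cylinders of its
window**: `∫⁻_{(0,T) × K} ‖u‖² ≤ M² |(0,T) × K| < ∞` for compact `K`. [folklore] -/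
theorem lintegral_cylinder_sq_lt_top_of_bound {M : ℝ} (hM : ∀ t ∈ Ioo 0 T, ∀ x, ‖u t x‖ ≤ M)
    {K : Set E} (hK : IsCompact K) :
    ∫⁻ z in Ioo 0 T ×ˢ K, ‖uncurry u z‖ₑ ^ 2 < ∞ := by
  have hle : ∀ z ∈ Ioo 0 T ×ˢ K, ‖uncurry u z‖ₑ ^ 2 ≤ ENNReal.ofReal (M ^ 2) := by
    rintro ⟨t, x⟩ ⟨ht, -⟩
    have hM0 : 0 ≤ M := (norm_nonneg _).trans (hM t ht x)
    rw [← ofReal_norm, ← ENNReal.ofReal_pow (norm_nonneg _)]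
    exact ENNReal.ofReal_le_ofReal (pow_le_pow_left₀ (norm_nonneg _) (hM t ht x) 2)
  calc ∫⁻ z in Ioo 0 T ×ˢ K, ‖uncurry u z‖ₑ ^ 2
      ≤ ∫⁻ _ in Ioo 0 T ×ˢ K, ENNReal.ofReal (M ^ 2) :=
        setLIntegral_mono' (measurableSet_Ioo.prod hK.measurableSet) hle
    _ = ENNReal.ofReal (M ^ 2) * volume (Ioo 0 T ×ˢ K) := by
        rw [setLIntegral_const]
    _ < ∞ := ENNReal.mul_lt_top ENNReal.ofReal_lt_top (volume_Ioo_prod_lt_top hK)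

/-- **A bounded suitable weak solution on `(0, T) × E` is a bounded weak solution of KNSS on
`(0, T)`** (Caffarelli–Kohn–Nirenberg 1982, (2.1)–(2.5) ⟹ Koch–Nadirashvili–Seregin–Šverák 2009,
§4 (ii)): for `(u, p)` suitable weak (unforced, viscosity `ν`) on the open slab with
`‖u(t, x)‖ ≤ M` for `0 < t < T`, `u` is a.e.-strongly measurable and bounded on the slab, its slices
are weakly divergence free at a.e. time (`SuitableRestart.ae_isWeaklyDivFree_slice`), and for every space–time test
`ψ` on the slab with divergence-free slices `∫_{(0,T)} ∫ (⟪u, ∂ₜψ⟫ + ⟪u, (u·∇)ψ⟫ + ν ⟪u, Δψ⟫) = 0`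
(the pressure term of the distributional identity drops, and Fubini).
[cite: KochNadirashviliSereginSverak2009, §4 p. 8 (ii) (arXiv:0709.3599)] -/
theorem IsSuitableWeakSolutionOn.isBoundedWeakNSSolutionOn_of_bound
    (hs : IsSuitableWeakSolutionOn (slab E (Ioo 0 T) isOpen_Ioo) ν 0 u p)
    {M : ℝ} (hM : ∀ t ∈ Ioo 0 T, ∀ x, ‖u t x‖ ≤ M) :
    IsBoundedWeakNSSolutionOn (Ioo 0 T) isOpen_Ioo ν u := by
  obtain ⟨hL1, -, -, -, hmomQ⟩ := hs.distributional
  have hmeas : AEStronglyMeasurable (uncurry u)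
      ((volume : Measure (ℝ × E)).restrict (Ioo 0 T ×ˢ univ)) := by
    have h := hL1.aestronglyMeasurable
    rwa [coe_slab] at h
  refine ⟨hmeas, ⟨M, hM⟩, ?_, fun ψ hψ hdiv => ?_⟩
  · -- weakly divergence-free slices at a.e. time
    have h := SuitableRestart.ae_isWeaklyDivFree_slice hs (a := 0) (b := T) (by rw [coe_slab])
    exact (ae_restrict_iff' measurableSet_Ioo).2 h
  · -- the pressure-free identity, iterated
    have hu : ∀ K : Set E, IsCompact K → ∫⁻ z in Ioo 0 T ×ˢ K, ‖uncurry u z‖ₑ ^ 2 < ∞ :=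
      fun K hK => lintegral_cylinder_sq_lt_top_of_bound hM hK
    have hUK : ∀ K : Set E, IsCompact K → IntegrableOn (uncurry u) (Ioo 0 T ×ˢ K) volume ∧
        IntegrableOn (fun z => ‖uncurry u z‖ ^ 2) (Ioo 0 T ×ˢ K) volume := fun K hK =>
      integrableOn_cylinder_of_lintegral_sq_slab hmeas hu hK
    -- the compact `x`-shadow of `ψ`
    obtain ⟨K, hK, hKt⟩ := hψ.exists_compact_slice_subset
    have hψ0 : ∀ t x, x ∉ K → ψ t x = 0 := fun t x hx =>
      image_eq_zero_of_notMem_tsupport fun h' => hx (hKt t h')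
    -- regularity of the test-field ingredients as functions on `ℝ × E`
    have cψ' : Continuous (uncurry (timeDeriv ψ)) := hψ.continuous_timeDeriv
    have cD : Continuous fun z : ℝ × E => fderiv ℝ (ψ z.1) z.2 := by
      have h := ((hψ.isSmoothSpaceTimeOn univ).fderiv_slice uniqueDiffOn_univ).continuousOn
      rw [univ_prod_univ, continuousOn_univ] at h
      exact h
    have cL : Continuous fun z : ℝ × E => Δ (ψ z.1) z.2 := by
      have h := ((hψ.isSmoothSpaceTimeOn univ).laplacian uniqueDiffOn_univ).continuousOn
      rw [univ_prod_univ, continuousOn_univ] at h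
      exact h
    have hD0 : ∀ t x, x ∉ K → fderiv ℝ (ψ t) x = 0 := fun t x hx =>
      fderiv_of_notMem_tsupport ℝ fun h => hx (hKt t h)
    have hL0 : ∀ t x, x ∉ K → Δ (ψ t) x = 0 := fun t x hx =>
      laplacian_eq_zero_of_notMem_tsupport fun h => hx (hKt t h)
    have hψ'0 : ∀ t x, x ∉ K → timeDeriv ψ t x = 0 := fun t x hx =>
      timeDeriv_eq_zero_of_forall (fun s => hψ0 s x hx) t
    -- integrability on the slab
    obtain ⟨hUK1, hUK2⟩ := hUK K hK
    have iA : Integrable (fun z : ℝ × E => ⟪u z.1 z.2, timeDeriv ψ z.1 z.2⟫)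
        (((volume : Measure ℝ).restrict (Ioo 0 T)).prod (volume : Measure E)) :=
      integrable_slab_inner hK hUK1 cψ' hψ'0
    have iB : Integrable (fun z : ℝ × E => ⟪u z.1 z.2, convect (u z.1) (ψ z.1) z.2⟫)
        (((volume : Measure ℝ).restrict (Ioo 0 T)).prod (volume : Measure E)) :=
      integrable_slab_inner_clm_apply hK hUK1 hUK2 cD hD0
    have iC : Integrable (fun z : ℝ × E => ⟪u z.1 z.2, Δ (ψ z.1) z.2⟫)
        (((volume : Measure ℝ).restrict (Ioo 0 T)).prod (volume : Measure E)) :=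
      integrable_slab_inner hK hUK1 cL hL0
    set Φ : ℝ × E → ℝ := fun z => ⟪u z.1 z.2, timeDeriv ψ z.1 z.2⟫ +
      ⟪u z.1 z.2, convect (u z.1) (ψ z.1) z.2⟫ + ν * ⟪u z.1 z.2, Δ (ψ z.1) z.2⟫ with hΦ
    have iΦ : Integrable Φ (((volume : Measure ℝ).restrict (Ioo 0 T)).prod (volume : Measure E)) :=
      (iA.add iB).add (iC.const_mul ν)
    -- the distributional identity: no force, and the pressure term drops since `div ψ = 0`
    have key := hmomQ ψ hψ
    rw [coe_slab] at key
    have key' : ∫ z in Ioo 0 T ×ˢ (univ : Set E), Φ z = 0 := by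
      refine Eq.trans (setIntegral_congr_fun (measurableSet_Ioo.prod MeasurableSet.univ)
        fun z _ => ?_) key
      rw [hΦ]
      dsimp only
      rw [hdiv z.1 z.2]
      simp only [mul_zero, add_zero, Pi.zero_apply, inner_zero_left]
    rw [volume_restrict_slab_eq, integral_prod _ iΦ] at key'
    exact key'

/-- **Window form**: if `(u, p)` is suitable weak (unforced) on
`(a, b) × E` and `‖u(t, x)‖ ≤ M` for `a < t < b`, then the time translate `u(a + ·)` is a bounded
weak solution of KNSS on `(0, b − a)` (time translation of suitable weak solutions,
`IsSuitableWeakSolutionOn.timeShift`, then `isBoundedWeakNSSolutionOn_of_bound`). This is the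
normalised window on which KNSS's Lemma 3.1 (`KNSS2009_weak_driftMild`) is stated.
[cite: KochNadirashviliSereginSverak2009, §4 p. 8 (ii) (arXiv:0709.3599)] -/
theorem IsSuitableWeakSolutionOn.isBoundedWeakNSSolutionOn_timeShift_of_bound {a b : ℝ}
    (hs : IsSuitableWeakSolutionOn (slab E (Ioo a b) isOpen_Ioo) ν 0 u p)
    {M : ℝ} (hM : ∀ t ∈ Ioo a b, ∀ x, ‖u t x‖ ≤ M) :
    IsBoundedWeakNSSolutionOn (Ioo 0 (b - a)) isOpen_Ioo ν (fun s y => u (a + s) y) := by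
  have h1 := hs.timeShift a
  rw [sub_self] at h1
  exact h1.isBoundedWeakNSSolutionOn_of_bound fun s hs' y =>
    hM (a + s) ⟨by linarith [hs'.1], by linarith [hs'.2]⟩ y

end Literature.Analysis.FluidPDE

end
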